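import Literature.IUT.LogVolume.Corollary22PartIAll
import Literature.IUT.LogVolume.Corollary22PartIILemmas
import Literature.IUT.LogVolume.Corollary22TateInput
import Literature.NumberTheory.DiophantineGeometry.GenEllMell
import Summits.ABC.IUTFork.Joshi.InitialThetaDataJoshi
import Summits.ABC.IUTFork.Joshi.ATS4Differents
import HarnessLib

/-!
# [J-IV] §5.4–§5.7: `Tate`, `Tate_Ψ`, `Tate2` (Def. 5.4.1, (5.4.2), Rmk. 5.4.3), the height comparison Prop. 5.6.1, and the
# Existence Theorem 5.7.1 («my formulation of [IUTchIV] Cor. 2.2 (i,ii)») — TYPED over the tree's [IUTchIV] Cor. 2.2 vocabulary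

Record file (D-0012) of the abc-iut cell, block E «type Joshi's construction, test vs S» (rung LADDER-ABC:A2.E; human ruling D-0078; seat
abc-iut-E-t28, slot T-28 of `HOME/plan/E/ASSIGNMENTS.md`; inventory `HOME/plan/E/t28/INVENTORY.tsv`). TAKES NO SIDE on [IUTchIII] Cor. 3.12, on the
claims of K. Joshi, or on S. Mochizuki's reports on them; typed ≠ proved; typed AS A CANDIDATE ≠ endorsed; NO abc claim. SOURCE (own reading of the
cell's render `HOME/lit/renders/Joshi-arxiv-2403.10430/pNNNN.txt`; «p.N l.M» = line M of page file N): K. Joshi, *Construction of Arithmetic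
Teichmüller Spaces IV: Proof of the abc-conjecture*, arXiv:2403.10430v2 («Preliminary version for comments», UNREFEREED) = [J-IV], §5 pp. 49–57. Every
statement [J-IV] ASSERTS is a `def … : Prop` tagged `@[claim "Joshi2024ATS4" "disputed"]` (the registered status word records that a dispute about the
series exists in print; no side taken), never an axiom / instance / `sorry` / Literature fact; what FOLLOWS from the typed signature or from theorems
already PROVED in the tree is a proved `theorem`. OUR side is imported BY NAME, never restated (DEFS-FREEZE); no `Cor312*` / `Thm311*` import (E-PLAN
R14).

WHAT IS TYPED / DICTIONARY (E3). §5.1 (p.49 l.33–p.50 l.50) bounding domains `Z = ∏_{v∈S} Z_v ⊂ X_S` («`G_S`-stable, compact … the closure of its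
interior», `S ⊇ V^arc`) and `Z(Z,S) ⊂ X(Q̄)` (5.1.2): for the only `X` §5.5–5.7 use (`U = ℙ¹∖{0,1,∞}` over `ℚ`) this IS the tree's [GenEll] Ex. 1.3
record `GenEll.CBData` (`primes`, `Karc`, `Knon`, compact-domain / Galois-stability fields) with `CBData.toSet = Z(Z,S)` — cited BY NAME, (5.1.2)
unfolded in `mem_compactlyBounded_iff` (Joshi, p.49 l.33–35: «different (but equivalent) to [Mochizuki, 2010]»; the arithmeticoid `arith(L)_y` only
supplies the ambient fields `K_{y_v} ⊃ Q̄_{p_v}`, the SET (5.1.2) does not depend on it; TODO(general form): general `X/L`). §5.3 (p.51 l.27–33) `C_λ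
: y² = x(x−1)(x−λ)`, `L_mod = ℚ(j_λ)`: `legendrePt` (= the tree's `Cor22.thetaEllPoint` at `F = ℚ(λ)`, `legendrePt_eq`), `Cor22.jInv`, `Cor22.dmod`.
**Def. 5.4.1** (p.51 l.43–56) `Tate(C/M) = (1/[M:ℚ])·Σ_w ord_w(q_w)·log w : M_ell(Q̄) → ℝ` and **(5.4.2)** (p.52 l.1–15) `Tate_Ψ`, `Tate2 :=
Tate_{2}`, on presented points `[C] ∈ M_ell(Q̄)` (`GenEll.EllPoint`), `ord_w(q_w)` rendered as everywhere in the tree ([GenEll] §3 file: Tate's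
`v(q_E) = −v(j_E)`) by `max(0, −ord_w(j))` (`tateOrd`), Joshi's normalized degree (4.2.1)–(4.2.2) by `Literature.IUT.LogVolume.FinDivisor.ndeg`
(`tateDivisor`, `tateAvoid`, `tate`, `tate2`). **Rmk. 5.4.3** (p.52 l.16–26), the TABLE «[IUTchIV] `q^∀(−)` ↔ `Tate(−)`, `q^{∤2}(−)` ↔ `Tate2(−)`»:
PROVED as `tate_legendrePt : tate [C_λ] = Cor22.logQForall λ`, `tate2_legendrePt : tate2 [C_λ] = Cor22.logQNotTwo λ`. §5.5 (p.52 l.27–47):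
`h_{ω_{ℙ¹}(D)}` = `GenEll.NFPoint.ht`, `U(Q̄)_{≤d}` = `GenEll.UPle d`, `h_∞` (5.5.2) = `Cor22.htInfty` = `GenEll.EllPoint.htInf ∘ (5.5.1)`
(`htInf_legendrePt`, PROVED). **(5.6.2)** (p.53 l.4–6) = `Cond562` ⟺ the tree's `Cor22.JInvBounded` (PROVED); **Prop. 5.6.1** (p.53 l.2–18) = the
claim `Prop561`, whose BD-chain under the table IS the tree's `Cor22.PartI` ([IUTchIV] Cor. 2.2 (i)) — `prop561_holds` PROVED from the tree's
`Cor22.partI_holds` (DISCHARGED; classical). **Thm. 5.7.1** (p.53 l.31–45) = the claim `Thm571`, AS PRINTED (`δ = d*_mod`, window «`log(2·δ·log(Q))`»,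
conclusion «satisfies Initial Theta Data [J-III §3.1, §3.3] … with the prime `ℓ`» = `HasInitialThetaData` over E-t6's
`Summit.ABC.IUTFork.Joshi.ATS3.InitialThetaData` and the tree's theta fields `Cor22.IsThetaField`), factored through the generic `Thm571With W ITD` so
that the variants compare in the kernel: `Thm571Lem587` (window «`log(2·δ·Q)`» of Lem. 5.8.7 (1) = [IUTchIV] (C1)) and the proof-level reading
`ITDConditions` (OUR READING of «Completion of the Proof», p.57 l.17–26).

FAITHFULNESS FLAGS (referee lane; numbers, not adjectives). (a) The `ℓ`-window is printed «`log(2·δ·log(Q))`» in Thm. 5.7.1 (p.53 l.43) and Lem. 5.8.2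
(p.55 l.13) but «`log(2·δ·Q)`» in Lem. 5.8.7 (1) (p.56 l.36) and (5.8.4) (p.55 l.49); [IUTchIV] (C1) reads «`log(2δ·log(q^∀))`» where `log(q^∀)` is
the NUMBER Joshi calls `Q` (Rmk. 5.4.3) — one extra logarithm in print; both typed, `lWindow_of_printed` (printed ⇒ Lem-5.8.7 form for `Q, δ ≥ 1`)
PROVED. (b) `δ = d*_mod = 2^12·3^3·5·[L_mod:ℚ]` depends on the point and is `≤` Mochizuki's `δ = 2^12·3^3·5·d` (`deltaMod_le_delta`): Joshi's window
is NARROWER; Lem-5.8.7 window ⇒ (C1) window (`conditionC1_of_lem587Window`, PROVED). (c) «`d ∈ ℕ`» read `d ≥ 1`. (d) Joshi places `Z` on `M_ell(Q̄)`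
yet evaluates `h_{ω_{ℙ¹}(D)}` (a function on `U`) on it and intersects it with `U(Q̄)_{≤d}` along (5.5.1): typed, as [IUTchIV] Cor. 2.2 is, with `Z =
K_V ⊆ U(Q̄)` (`CBData`) and the `M_ell`-functions pulled back along `legendrePt`; a `CBData` need not be `j`-saturated (formally more `Z`'s than
print). (e) «§4.1.1, §4.1.2» ([J-IV] §4.1, slot T-26): (6) `ℓ ≥ 5` is `ATS3.InitialThetaData.five_le`, (7) (9) are `Cor22.IsThetaField`, (2)–(5)
notation, (1) (4) (8) consequences — not separately typed here (merge-debt T-26). B3 xref (R7): none of RP-J01–J06 is Thm. 5.7.1. Proof-only sequel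
(planned): `Joshi/ATS4InitialThetaDataExistenceProofs.lean`, `Cor22.FullGaloisImage → Thm571With lem587Window ITDConditions` (classical; no Theorem
1.10). [claim: Joshi2024ATS4, status: disputed] [claim: Mochizuki2012, status: disputed]
-/

noncomputable section

open scoped Classical
open NumberField IsDedekindDomain
open Literature.NumberTheory.DiophantineGeometry.GenEll Literature.IUT.LogVolume

namespace Summit.ABC.IUTFork.Joshi.ATS4

/-! ## §5.1 Bounding domains and compactly bounded subsets (cited BY NAME: `GenEll.CBData`) -/

/-- **[J-IV] §5.1, (5.1.2), p.50 l.36–50** — «`Z = {x : if x ∈ X(M) for some finite extension L ⊆ M ⊂ L̄ then for each embedding ι : M → ∏_{v∈S}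
Q̄_{p_v}, one has ι(x) ∈ Z ⊂ X_S} ⊂ X(Q̄)` … the `S`-supported, compactly bounded domain determined by the bounding domain `Z`», for `X = U = ℙ¹ ∖
{0,1,∞}` over `ℚ`: membership of a presented point `x ∈ U(M)` in the tree's `CBData.toSet` UNFOLDS to exactly this sentence (`Z_∞ = Karc`, `Z_p = Knon
p` for `p ∈ S ∖ {∞} = primes`; the embeddings `ι` are the ring maps `M →+* ℂ`, `M →+* Q̄_p`). The bounding domain itself («`G_S`-stable, compact
subset … the closure of its interior», p.50 l.29–32) is the record `CBData` (fields `Karc_isCompact`, `Karc_closure_interior`, `Karc_conj`,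
`Knon_galois`, `Knon_compactDomain`). PROVED (`Iff.rfl`). [claim: Joshi2024ATS4, status: disputed] -/
theorem mem_compactlyBounded_iff (Z : CBData) (P : NFPoint) :
    P ∈ Z.toSet ↔ (∀ ι : P.F →+* ℂ, ι P.x ∈ Z.Karc) ∧
      ∀ p ∈ Z.primes, ∀ [Fact p.Prime], ∀ ι : P.F →+* PadicAlgCl p, ι P.x ∈ Z.Knon p :=
  Iff.rfl

/-! ## §5.4 Def. 5.4.1 and (5.4.2): `Tate`, `Tate_Ψ`, `Tate2` on `M_ell(Q̄)` -/
section Mell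

variable (E : EllPoint)

/-- **[J-IV] Def. 5.4.1, p.51 l.43–46: `ord_w(q_w)`** — «let `q_w` at `C_{M_w}` be a Tate parameter (well defined up to multiplication by a local unit
and its order at `w`)»: the order at `w` of a Tate parameter, RENDERED (tree convention of `GenEll.EllPoint.localHeight`, [GenEll] Def. 3.3 / Rmk.
3.3.1, Tate's `v(q_E) = −v(j_E)` at a prime of potentially multiplicative reduction) as `max(0, −ord_w(j(C)))` — `0` at the primes where no Tate
parameter exists. OUR nearest typed object: `GenEll.EllPoint.localHeight` (the integer `−ord_w(j)`). [claim: Joshi2024ATS4, status: disputed] -/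
def tateOrd (w : HeightOneSpectrum (𝓞 E.F)) : ℕ := (E.localHeight w).toNat

/-- The finite set of primes `w ∈ V^non_M` with `ord_w(q_w) > 0`, i.e. `ord_w(j(C)) < 0` (potentially multiplicative reduction): the support of the
sum in Def. 5.4.1 (Mathlib's `HeightOneSpectrum.Support` of `j(C)`, finite). On the `λ`-line this is the tree's `Cor22.badPlaces` (cf.
`tateAvoid_legendrePt`). [claim: Joshi2024ATS4, status: disputed] -/
def tateSupport : Finset (HeightOneSpectrum (𝓞 E.F)) :=
  (HeightOneSpectrum.Support.finite (R := 𝓞 E.F) E.W.j).toFinset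

/-- **[J-IV] (5.4.2), p.52 l.1–12**: the arithmetic divisor «`Σ_{w ∤ p ∈ Ψ} ord_w(q_w)`·`w`» («the portion of `Tate(C/M)` which is not supported on
any of the primes of `M` lying over the rational prime `p ∈ Ψ`»; `Ψ = ∅`: the whole divisor of Def. 5.4.1 over ALL `w ∈ V^non_M` — contrast Def.
4.4.2, restricted to `V^{odd,ss}`), as a `FinDivisor` (the tree's `Literature.IUT.LogVolume.ArakelovDivisors` = Joshi's arithmetic divisors §4.2.1).
[claim: Joshi2024ATS4, status: disputed] -/
def tateDivisor (Ψ : Finset ℕ) : FinDivisor E.F :=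
  ∑ w ∈ (tateSupport E).filter (fun w => ∀ p ∈ Ψ, ((p : ℕ) : 𝓞 E.F) ∉ w.asIdeal), FinDivisor.of w (tateOrd E w : ℝ)

/-- **[J-IV] (5.4.2), p.52 l.1–15: `Tate_Ψ(C/M) = (1/[M:ℚ])·deg(Σ_{w ∤ p ∈ Ψ} ord_w(q_w)) ∈ ℝ`** — «the logarithmic degree of the portion of
`Tate(C/M)` which is not supported on any of the primes … over … `p ∈ Ψ`», `deg` = Joshi's arithmetic degree (4.2.1) (which supplies the weights `log
w`), `(1/[M:ℚ])·deg` = his normalized degree (4.2.2) = the tree's `FinDivisor.ndeg`. On the `λ`-line: `= Cor22.logQAvoid λ Ψ`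
(`tateAvoid_legendrePt`). [claim: Joshi2024ATS4, status: disputed] -/
def tateAvoid (Ψ : Finset ℕ) : ℝ := FinDivisor.ndeg E.F (tateDivisor E Ψ)

/-- **[J-IV] Def. 5.4.1, p.51 l.43–56: `Tate(C/M) = (1/[M:ℚ])·Σ_{w ∈ V^non} ord_w(q_w)·log w`**, «`Tate : M_ell(Q̄) → ℝ` … with the elliptic curve `C`
being viewed over its field of moduli … a well defined `ℝ`-valued function on `M_ell(Q̄)`» — on a presented point `[C] ∈ M_ell(Q̄)`
(`GenEll.EllPoint`, any presenting field `M ∋ j(C)`: the normalized value does not depend on `M` — [J-IV] Prop. 4.4.4, slot T-26 — so «over its field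
of moduli» is immaterial and not imposed); `= tateAvoid [C] ∅`. Rmk. 5.4.3: `=` [IUTchIV] `log(q^∀)`. OUR nearest typed objects:
`GenEll.EllPoint.degInf` (`deg_∞`, the same number), `Cor22.logQForall` (`tate_legendrePt`). [claim: Joshi2024ATS4, status: disputed] -/
def tate : ℝ := tateAvoid E ∅

/-- **[J-IV] (5.4.2), p.52 l.13–15: `Tate2 := Tate_{2}`** («In [Mochizuki, 2021d], the choice of `Ψ = {2}` is used»). Rmk. 5.4.3: `=` [IUTchIV]
`log(q^{∤2})`; on the `λ`-line `= Cor22.logQNotTwo` (`tate2_legendrePt`). [claim: Joshi2024ATS4, status: disputed] -/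
def tate2 : ℝ := tateAvoid E {2}

/-- `Tate_Ψ ≥ 0` (an effective divisor: `ord_w(q_w) ≥ 0`). PROVED. [claim: Joshi2024ATS4, status: disputed] -/
theorem tateAvoid_nonneg (Ψ : Finset ℕ) : 0 ≤ tateAvoid E Ψ := by
  unfold tateAvoid tateDivisor
  refine FinDivisor.ndeg_nonneg fun v => ?_
  rw [Finset.sum_apply']
  exact Finset.sum_nonneg fun w _ => by
    unfold FinDivisor.of
    rw [Finsupp.single_apply]
    split_ifs <;> simp

/-- `Tate_Ψ ≤ Tate_{Ψ′}` for `Ψ′ ⊆ Ψ` (removing the primes over more rational primes lowers the degree); in particular `Tate2 ≤ Tate`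
(`tate2_le_tate`), the content of «`Tate ≈ Tate2 ≤ …`» in (5.8.10). PROVED. [claim: Joshi2024ATS4, status: disputed] -/
theorem tateAvoid_anti {Ψ Ψ' : Finset ℕ} (h : Ψ' ⊆ Ψ) : tateAvoid E Ψ ≤ tateAvoid E Ψ' := by
  unfold tateAvoid tateDivisor
  rw [FinDivisor.ndeg_apply, FinDivisor.ndeg_apply, map_sum, map_sum]
  apply div_le_div_of_nonneg_right _ (FinDivisor.finrank_pos (F := E.F)).le
  apply Finset.sum_le_sum_of_subset_of_nonneg
  · intro v hv
    rw [Finset.mem_filter] at hv ⊢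
    exact ⟨hv.1, fun p hp => hv.2 p (h hp)⟩
  · intro v _ _
    rw [FinDivisor.deg_of]
    exact mul_nonneg (Nat.cast_nonneg _) (logNorm_pos E.F v).le

/-- `Tate2(C/M) ≤ Tate(C/M)`. PROVED. [claim: Joshi2024ATS4, status: disputed] -/
theorem tate2_le_tate : tate2 E ≤ tate E := tateAvoid_anti E (Finset.empty_subset _)

end Mell

/-! ## §5.3 / §5.5: the Legendre curve `C_λ` as a point of `M_ell(Q̄)`; Rmk. 5.4.3's table PROVED -/
section Legendre

/-- **[J-IV] §5.3, p.51 l.27–33 and (5.5.1), p.52 l.35–39**: «`U ∋ λ ↦ C_λ : y² = x(x−1)(x−λ)`», the classifying morphism `U → M_ell`, on presented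
points: `[C_λ] ∈ M_ell(Q̄)` presented over the field `F = ℚ(λ)` of `λ ∈ U(F)` (`λ ≠ 0, 1`), Weierstrass model `⟨0, −(1+λ), 0, λ, 0⟩` (elliptic by the
tree's `Cor22.isElliptic_legendre`) — the tree's `Cor22.thetaEllPoint λ · F` at `F = ℚ(λ)` itself (`legendrePt_eq`). [claim: Joshi2024ATS4, status:
disputed] -/
def legendrePt (P : NFPoint) (hU : P.InU) : EllPoint :=
  @EllPoint.mk P.F _ _ ⟨0, -(1 + P.x), 0, P.x, 0⟩ (Cor22.isElliptic_legendre P hU)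

/-- `[C_λ]` is the tree's `Cor22.thetaEllPoint λ hU ℚ(λ)` ([IUTchIV] Cor. 2.2's «`E_F`» over `F = F_tpd`). PROVED (`rfl`). [folklore] -/
theorem legendrePt_eq (P : NFPoint) (hU : P.InU) : legendrePt P hU = Cor22.thetaEllPoint P hU P.F := rfl

/-- **[J-IV] §5.3, p.51 l.29–32** «`j_λ` is a rational function of `λ`» [Silverman III.1.7]: `j(C_λ) = 2⁸(λ²−λ+1)³/(λ²(λ−1)²)` = the tree's
`Cor22.jInv λ` (PROVED from the tree's `Cor22.j_legendre`). [folklore] -/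
theorem j_legendrePt (P : NFPoint) (hU : P.InU) : (legendrePt P hU).W.j = Cor22.jInv P.x :=
  @Cor22.j_legendre P hU (Cor22.isElliptic_legendre P hU)

/-- **Rmk. 5.4.3 TABLE, general entry**: `Tate_Ψ(C_λ) =` the tree's `log(q^{∤Ψ}(λ))` (`Cor22.logQAvoid λ Ψ`, the normalized degree of the
`q`-parameter divisor away from `Ψ` of [IUTchIV] Cor. 2.2's typing: same support — the poles of `j(λ)`, `Cor22.badPlaces` — and same coefficients
`max(0, −ord_w(j(λ)))` = `Cor22.localHeight`). PROVED. [claim: Joshi2024ATS4, status: disputed] -/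
theorem tateAvoid_legendrePt (P : NFPoint) (hU : P.InU) (Ψ : Finset ℕ) : tateAvoid (legendrePt P hU) Ψ = Cor22.logQAvoid P Ψ := by
  haveI := Cor22.isElliptic_legendre P hU
  show FinDivisor.ndeg P.F (∑ w ∈ ((HeightOneSpectrum.Support.finite (R := 𝓞 P.F)
      (WeierstrassCurve.j (⟨0, -(1 + P.x), 0, P.x, 0⟩ : WeierstrassCurve P.F))).toFinset).filter
        (fun w => ∀ p ∈ Ψ, ((p : ℕ) : 𝓞 P.F) ∉ w.asIdeal),
      FinDivisor.of w (((-(ord P.F w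
        (WeierstrassCurve.j (⟨0, -(1 + P.x), 0, P.x, 0⟩ : WeierstrassCurve P.F)))).toNat : ℕ) : ℝ)) =
    FinDivisor.ndeg P.F (∑ v ∈ (Cor22.badPlaces P).filter (fun v => ∀ p ∈ Ψ, ((p : ℕ) : 𝓞 P.F) ∉ v.asIdeal),
      FinDivisor.of v (Cor22.localHeight P v))
  rw [Cor22.j_legendre P hU]
  rfl

/-- **[J-IV] Rmk. 5.4.3, p.52 l.16–22 — TABLE row «[Mochizuki, 2021d] `q^∀(−)` ↔ This paper `Tate(−)`»**: `Tate(C_λ) =` the tree's `log(q^∀(λ))`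
(`Cor22.logQForall`). PROVED. [claim: Joshi2024ATS4, status: disputed] -/
theorem tate_legendrePt (P : NFPoint) (hU : P.InU) : tate (legendrePt P hU) = Cor22.logQForall P := tateAvoid_legendrePt P hU ∅

/-- **[J-IV] Rmk. 5.4.3, p.52 l.16–22 — TABLE row «[Mochizuki, 2021d] `q^{∤2}(−)` ↔ This paper `Tate2 := Tate_{2}(−)`»**: `Tate2(C_λ) =` the tree's
`log(q^{∤2}(λ))` (`Cor22.logQNotTwo`). PROVED. [claim: Joshi2024ATS4, status: disputed] -/
theorem tate2_legendrePt (P : NFPoint) (hU : P.InU) : tate2 (legendrePt P hU) = Cor22.logQNotTwo P := tateAvoid_legendrePt P hU {2}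

/-- **[J-IV] (5.5.2), p.52 l.44–47: `h_∞ : U(Q̄) → ℝ`** «the height function on `U` defined by this pull-back of the divisor at infinity of `M̄_ell`»:
the tree's representative `ht_∞([C]) = (1/[F:ℚ])·h(j(C))` on `M_ell(Q̄)` (`GenEll.EllPoint.htInf`) pulled back along (5.5.1) IS the tree's
`Cor22.htInfty λ` of [IUTchIV] Cor. 2.2 (i). PROVED. (And `h_{ω_{ℙ¹}(D)} = h_{O(1)}`, p.52 l.33–34, is `GenEll.NFPoint.ht`, BY NAME.) [claim:
Joshi2024ATS4, status: disputed] -/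
theorem htInf_legendrePt (P : NFPoint) (hU : P.InU) : (legendrePt P hU).htInf = Cor22.htInfty P := by
  haveI := Cor22.isElliptic_legendre P hU
  show ((Module.finrank ℚ P.F : ℕ) : ℝ)⁻¹ *
      Height.logHeight₁ (WeierstrassCurve.j (⟨0, -(1 + P.x), 0, P.x, 0⟩ : WeierstrassCurve P.F)) = _
  rw [Cor22.j_legendre P hU]
  rfl

end Legendre

/-! ## §5.6 Height comparisons: (5.6.2) and Prop. 5.6.1 -/

/-- **[J-IV] (5.6.2), p.53 l.4–6: «`Z_2 ⊂ 2^{N_jinv}·O_{Q̄_2}` for some integer `N_jinv ∈ ℤ` (this implies that if `C_λ ∈ Z(Z,S)` then the image of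
`C_λ` under the `j`-invariant mapping is contained in `Z_2 ⊂ 2^{N_jinv}·O_{Q̄_2}` for every embedding of `ℚ(λ) ↪ Q̄_2`)»** — READING (flag (d)): the
`2`-adic component `Z_2 = Knon 2` of the bounding domain on `U`, read through `j_inv` as the parenthesis says: `|j(y)|_2 ≤ |2^{N}|_2 = 2^{−N}` on
`Z_2`. OUR nearest typed object: `Cor22.JInvBounded` ([IUTchIV] (∗^{j-inv}) «is a bounded subset … i.e., is contained in a subset of the form
`2^{N_{j-inv}}·O_{Q̄_v}`»), PROVED equivalent (`cond562_iff_jInvBounded`). [claim: Joshi2024ATS4, status: disputed] -/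
def Cond562 (Z : CBData) : Prop := ∃ N : ℤ, ∀ y ∈ Z.Knon 2, ‖Cor22.jInv y‖ ≤ (2 : ℝ) ^ (-N)

/-- (5.6.2) ⟺ [IUTchIV] (∗^{j-inv}) as typed in the tree (`Cor22.JInvBounded`: `∃ C, ‖j(y)‖ ≤ C` on `Z_2`). PROVED. [claim: Joshi2024ATS4, status:
disputed] -/
theorem cond562_iff_jInvBounded (Z : CBData) : Cond562 Z ↔ Cor22.JInvBounded Z := by
  refine ⟨fun ⟨N, hN⟩ => ⟨(2 : ℝ) ^ (-N), hN⟩, fun ⟨C, hC⟩ => ?_⟩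
  obtain ⟨n, hn⟩ := pow_unbounded_of_one_lt C (by norm_num : (1 : ℝ) < 2)
  refine ⟨-(n : ℤ), fun y hy => (hC y hy).trans ?_⟩
  rw [neg_neg, zpow_natCast]
  exact hn.le

/-- **[J-IV] Prop. 5.6.1, p.53 l.2–11** («This is standard [Mochizuki, 2010]», proof l.12–18): «Suppose `U` is as above and `{2, ∞} ⊆ S ⊂ V_ℚ` is a
finite subset of primes. Suppose `Z(Z,S) ⊂ M_ell(Q̄)` is an `S`-supported, compactly bounded subset. Assume that (5.6.2) … Then one has the following
equality of bounded discrepancy classes of functions: `(1/6)·Tate2 ≈ (1/6)·Tate ≈ (1/6)·h_∞ ≈ h_{ω_{ℙ¹}(D)}`.» TYPED with `Z` a compactly bounded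
subset of `U(Q̄)` whose support contains `2` (flag (d); `∞ ∈ S` is automatic for `CBData`) and the functions read through (5.5.1) and Rmk. 5.4.3
(`tate2_legendrePt`, `tate_legendrePt`, `htInf_legendrePt`): the BD-chain is then LITERALLY the tree's `Cor22.PartI Z` = [IUTchIV] Cor. 2.2 (i)
«`(1/6)·log(q^{∤2}) ≈ (1/6)·log(q^∀) ≈ (1/6)·ht_∞ ≈ ht_{ω_X(D)}` on `K_V`», cited BY NAME. DISCHARGED below (`prop561_holds`). [claim: Joshi2024ATS4,
status: disputed] -/
@[claim "Joshi2024ATS4" "disputed"]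
def Prop561 : Prop := ∀ Z : CBData, Z.SupportContains {2} → Cond562 Z → Cor22.PartI Z

/-- Prop. 5.6.1 as typed ⟺ «[IUTchIV] Cor. 2.2 (i) for every `K_V` satisfying the hypotheses of Cor. 2.2» (`Cor22.Hypotheses`: support `∋ 2` and
(∗^{j-inv})). PROVED. [claim: Joshi2024ATS4, status: disputed] -/
theorem prop561_iff : Prop561 ↔ ∀ Z : CBData, Cor22.Hypotheses Z → Cor22.PartI Z :=
  ⟨fun h Z hZ => h Z hZ.supp ((cond562_iff_jInvBounded Z).2 hZ.jinv),
    fun h Z h2 h562 => h Z ⟨h2, (cond562_iff_jInvBounded Z).1 h562⟩⟩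

/-- **Prop. 5.6.1 HOLDS** — PROVED from the tree's kernel-checked [IUTchIV] Cor. 2.2 (i) (`Cor22.partI_holds`, `Corollary22PartIAll.lean`: local
heights vs the Weil height of `j`, Northcott-free; classical, no Θ-data). DISCHARGED. [claim: Joshi2024ATS4, status: disputed] -/
theorem prop561_holds : Prop561 :=
  prop561_iff.2 fun Z hZ => Cor22.partI_holds Z hZ

/-! ## §5.7 The Existence Theorem 5.7.1 -/
section Existence

/-- **[J-IV] Thm. 5.7.1, p.53 l.35–36: «Let `d ∈ ℕ`, `δ = d*_mod = 2^12·3^3·5·d_mod`»** with `d_mod = [L_mod : ℚ]` (§4.1.1 (2)–(3), p.37 l.36–38),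
`L_mod = ℚ(j_λ)` (§5.3): E-t26's `ATS4.dStarMod L_mod` (ℕ, `ATS4Differents.lean`) at the subfield `L_mod = ℚ(j(λ)) ⊆ ℚ(λ)`, as a real number; `=
2^12·3^3·5·Cor22.dmod λ` (`deltaMod_eq`, the tree's `d_mod` of [IUTchIV] Thm. 1.10). A POINT-dependent `δ` (flag (b)): Mochizuki's `δ := 2^12·3^3·5·d`
is the tree's `Cor22.delta d`, and `d*_mod ≤ δ` for `λ ∈ U(Q̄)_{≤d}` (`deltaMod_le_delta`). [claim: Joshi2024ATS4, status: disputed] -/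
def deltaMod (P : NFPoint) : ℝ := (dStarMod (IntermediateField.adjoin ℚ ({Cor22.jInv P.x} : Set P.F)) : ℝ)

/-- `δ(λ) = d*_mod = 2^12·3^3·5·d_mod(λ)` with the tree's `Cor22.dmod λ = [ℚ(j(λ)):ℚ]`. PROVED. [claim: Joshi2024ATS4, status: disputed] -/
theorem deltaMod_eq (P : NFPoint) : deltaMod P = 2 ^ 12 * 3 ^ 3 * 5 * (Cor22.dmod P : ℝ) := by
  unfold deltaMod dStarMod dMod Cor22.dmod
  push_cast
  ring

/-- `0 < 2^12·3^3·5 ≤ δ(λ)` (`d_mod ≥ 1`, the tree's `Cor22.dmod_pos`). PROVED. [claim: Joshi2024ATS4, status: disputed] -/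
theorem deltaMod_pos (P : NFPoint) : 0 < deltaMod P := by
  have h : (1 : ℝ) ≤ Cor22.dmod P := by exact_mod_cast Cor22.dmod_pos P
  rw [deltaMod_eq]; nlinarith

/-- `δ(λ) = d*_mod(λ) ≤ 2^12·3^3·5·d` for `λ ∈ U(Q̄)_{≤d}` (the tree's `Cor22.dstar_le_delta`: `d_mod ≤ [ℚ(λ):ℚ] ≤ d`). PROVED. [claim: Joshi2024ATS4,
status: disputed] -/
theorem deltaMod_le_delta {P : NFPoint} {d : ℕ} (hP : P ∈ UPle d) : deltaMod P ≤ Cor22.delta d := by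
  rw [deltaMod_eq]; exact Cor22.dstar_le_delta P hP.2

/-- **The `ℓ`-window of Thm. 5.7.1 AS PRINTED, p.53 l.42–43: «`Q^{1/2} ≤ ℓ ≤ 10·δ·Q^{1/2}·log(2·δ·log(Q))`»** (flag (a): one logarithm more than Lem.
5.8.7 (1) / [IUTchIV] (C1)). [claim: Joshi2024ATS4, status: disputed] -/
def LWindowPrinted (δ Q : ℝ) (ℓ : ℕ) : Prop :=
  Real.sqrt Q ≤ ℓ ∧ (ℓ : ℝ) ≤ 10 * δ * Real.sqrt Q * Real.log (2 * δ * Real.log Q)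

/-- **The `ℓ`-window of Lem. 5.8.7 (1), p.56 l.35–36: «`Q^{1/2} ≤ ℓ ≤ 10·δ·Q^{1/2}·log(2·δ·Q)`»** = [IUTchIV] Cor. 2.2 (C1) «`(log(q^∀))^{1/2} ≤ l ≤
10δ·(log(q^∀))^{1/2}·log(2δ·log(q^∀))`» with `Q = log(q^∀)` (Rmk. 5.4.3) — the window the printed proof of Thm. 5.7.1 delivers («The existence of the
prime number `ℓ` … is given by Lemma 5.8.7», p.57 l.17–18). OUR nearest typed object: the first two conjuncts of `Cor22.ConditionsC1C2 d C_K λ l`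
(there with `δ = Cor22.delta d`). [claim: Joshi2024ATS4, status: disputed] -/
def LWindow (δ Q : ℝ) (ℓ : ℕ) : Prop :=
  Real.sqrt Q ≤ ℓ ∧ (ℓ : ℝ) ≤ 10 * δ * Real.sqrt Q * Real.log (2 * δ * Q)

/-- Printed window ⟹ Lem-5.8.7 window whenever `Q ≥ 1` and `δ ≥ 1` (`log Q ≤ Q`, so the printed upper bound is the SMALLER one; at the points Thm.
5.7.1 speaks about, `Q^{1/2} ≥ ξ_prm ≥ 5`, p.54 l.27–28). PROVED. [claim: Joshi2024ATS4, status: disputed] -/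
theorem lWindow_of_printed {δ Q : ℝ} {ℓ : ℕ} (hδ : 1 ≤ δ) (hQ : 1 ≤ Q) (h : LWindowPrinted δ Q ℓ) : LWindow δ Q ℓ := by
  refine ⟨h.1, h.2.trans ?_⟩
  have hc : 0 ≤ 10 * δ * Real.sqrt Q := by positivity
  refine mul_le_mul_of_nonneg_left ?_ hc
  have hlogQ : 0 ≤ Real.log Q := Real.log_nonneg hQ
  rcases hlogQ.eq_or_lt with h0 | hpos
  · rw [← h0, mul_zero, Real.log_zero]
    exact Real.log_nonneg (by nlinarith)
  · refine Real.log_le_log (by positivity) ?_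
    have : Real.log Q ≤ Q := (Real.log_le_sub_one_of_pos (by linarith)).trans (by linarith)
    nlinarith

/-- The Lem-5.8.7 window is MONOTONE in `δ`: for `0 < δ ≤ δ′` and `ℓ ≥ 1`, `LWindow δ Q ℓ ⟹ LWindow δ′ Q ℓ` (a non-empty window forces `Q > 0` and
`log(2δQ) > 0`). PROVED. [claim: Joshi2024ATS4, status: disputed] -/
theorem lWindow_mono {δ δ' Q : ℝ} {ℓ : ℕ} (hδ : 0 < δ) (hδδ' : δ ≤ δ') (hℓ : 1 ≤ ℓ) (h : LWindow δ Q ℓ) :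
    LWindow δ' Q ℓ := by
  obtain ⟨h1, h2⟩ := h
  refine ⟨h1, h2.trans ?_⟩
  have hℓ' : (1 : ℝ) ≤ ℓ := by exact_mod_cast hℓ
  have hsq : 0 ≤ Real.sqrt Q := Real.sqrt_nonneg Q
  have hA : 0 ≤ 10 * δ * Real.sqrt Q := by positivity
  -- the window is non-empty, so `log(2δQ) > 0` and `√Q > 0`
  have hL : 0 < Real.log (2 * δ * Q) := by
    refine not_le.mp fun hle => ?_
    have : 10 * δ * Real.sqrt Q * Real.log (2 * δ * Q) ≤ 0 := mul_nonpos_of_nonneg_of_nonpos hA hle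
    linarith
  have hsq' : 0 < Real.sqrt Q := by
    rcases hsq.eq_or_lt with h0 | hpos
    · exfalso
      rw [← h0, mul_zero, zero_mul] at h2
      linarith
    · exact hpos
  have hQ : 0 < Q := Real.sqrt_pos.mp hsq'
  have h2δQ : 0 < 2 * δ * Q := by positivity
  have hL' : Real.log (2 * δ * Q) ≤ Real.log (2 * δ' * Q) :=
    Real.log_le_log h2δQ (by nlinarith)
  have hδ'0 : 0 ≤ δ' := hδ.le.trans hδδ'
  calc 10 * δ * Real.sqrt Q * Real.log (2 * δ * Q)
      ≤ 10 * δ' * Real.sqrt Q * Real.log (2 * δ * Q) := by gcongr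
    _ ≤ 10 * δ' * Real.sqrt Q * Real.log (2 * δ' * Q) := by gcongr

/-- The printed `ℓ`-window of Thm. 5.7.1 at the point `λ`: `δ = d*_mod(λ)`, `Q = Tate(C_λ/L)` = the tree's `log(q^∀(λ))` (Rmk. 5.4.3 /
`tate_legendrePt`; base-change invariant, so `C_λ/L` vs `C_λ/ℚ(λ)` is immaterial — [J-IV] Prop. 4.4.4). [claim: Joshi2024ATS4, status: disputed] -/
def printedWindow (P : NFPoint) (ℓ : ℕ) : Prop := LWindowPrinted (deltaMod P) (Cor22.logQForall P) ℓ

/-- The Lem-5.8.7 `ℓ`-window at the point `λ` with Joshi's `δ = d*_mod(λ)`. [claim: Joshi2024ATS4, status: disputed] -/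
def lem587Window (P : NFPoint) (ℓ : ℕ) : Prop := LWindow (deltaMod P) (Cor22.logQForall P) ℓ

/-- **Joshi's window ⟹ Mochizuki's (C1) window.** For `λ ∈ U(Q̄)_{≤d}` and `ℓ ≥ 1`, the Lem-5.8.7 window with `δ = d*_mod(λ)` implies the (C1) window
of [IUTchIV] Cor. 2.2 (ii) as typed in the tree (first two conjuncts of `Cor22.ConditionsC1C2 d · λ ℓ`, `δ = Cor22.delta d = 2^12·3^3·5·d ≥ d*_mod`):
Joshi's Thm. 5.7.1 asserts the NARROWER window (flag (b)). PROVED. [claim: Joshi2024ATS4, status: disputed] -/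
theorem conditionC1_of_lem587Window {P : NFPoint} {d ℓ : ℕ} (hP : P ∈ UPle d) (hℓ : 1 ≤ ℓ) (h : lem587Window P ℓ) :
    Real.sqrt (Cor22.logQForall P) ≤ ℓ ∧
      (ℓ : ℝ) ≤ 10 * Cor22.delta d * Real.sqrt (Cor22.logQForall P) *
        Real.log (2 * Cor22.delta d * Cor22.logQForall P) :=
  lWindow_mono (deltaMod_pos P) (deltaMod_le_delta hP) hℓ h

/-- **[J-IV] Thm. 5.7.1, conclusion, p.53 l.44–45: «`C_λ` satisfies Initial-Theta Data [Joshi, 2024c, §3.1, §3.3] (also [Mochizuki, 2021a, §3.1]) and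
§4.1.1, §4.1.2, with the prime `ℓ`»**, for `λ ∈ U`, `L_mod` «the minimal field of definition», «`L = L_mod(√−1, C_λ[2·3·5])`» (p.53 l.40–41): TYPED
over E-t6's structure `Summit.ABC.IUTFork.Joshi.ATS3.InitialThetaData L L′ L̄ C ℓ` ([J-III] §3.1 (1)–(4) + §3.3 (9)–(14)) with Joshi's `L` = a theta
field of `λ` (the tree's `Cor22.IsThetaField λ F`: `F = ℚ(λ)(√−1, C_λ[15]) ⊇ ℚ(λ) = L_mod(C_λ[2]) = L_tpd`, §4.1.2 (7)–(9)), `C = C_λ ×_{ℚ(λ)} F`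
(`Cor22.thetaCurve`): for EVERY theta field `F` (they are `ℚ(λ)`-isomorphic; same quantifier discipline as the tree's `Cor22.CondP6`) there EXIST `L′
⊂ L̄` and a structure `ATS3.InitialThetaData F L′ L̄ C_{λ,F} ℓ`. Flag (e): the clauses of «§4.1.1, §4.1.2» not carried by `IsThetaField` / `five_le`
are notation or consequences (slot T-26). [claim: Joshi2024ATS4, status: disputed] -/
def HasInitialThetaData (P : NFPoint) (ℓ : ℕ) : Prop :=
  ∀ (hU : P.InU) (F : Type) [Field F] [NumberField F] [Algebra P.F F], Cor22.IsThetaField P F →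
    letI := Cor22.thetaCurve_isElliptic hU F
    ∃ (L' : Type) (_ : Field L') (_ : NumberField L') (_ : Algebra F L') (Lbar : Type) (_ : Field Lbar)
      (_ : Algebra F Lbar) (_ : Algebra L' Lbar), Nonempty (ATS3.InitialThetaData F L' Lbar (Cor22.thetaCurve P F) ℓ)

/-- **OUR READING of «Completion of the Proof of Theorem 5.7.1», p.57 l.17–26** — the arithmetic properties of `(C_λ, ℓ)` from which the text
concludes «All these results and properties imply that the `C_λ` is equipped with an Initial Theta Data»: `ℓ ≥ 7` (`ℓ ≥ Q^{1/2} ≥ ξ_prm ≥ 5`, p.54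
l.27–28, and `ℓ ≠ 5` since `C_λ[5] ⊆ C_λ(L)` kills (12) at `ℓ = 5`; the tree's (P7) constructor
`Literature.IUT.HodgeTheaters.exists_initialThetaData_of_conditions` takes `7 ≤ l`), Lem. 5.8.7 (2) «`ℓ ∤ a_v` for any `a_v ≠ 0`» = [IUTchIV] (P2) =
`Cor22.CondP2`, Lem. 5.8.9 / «`C_λ` has at least one prime of multiplicative reduction [not lying over `2·ℓ`] so `V^{odd,ss} ≠ ∅`» = (P5) =
`Cor22.CondP5`, Lem. 5.8.11 «`ρ_ℓ(G_L) ⊃ SL₂(𝔽_ℓ)`» = (P6) = `Cor22.CondP6` (Lem. 5.8.8 «no subgroup of order `ℓ`» = (P4) feeds (P6)). A READING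
predicate, NOT asserted in print as such; used as the `ITD` argument of `Thm571With` in the proof-only sequel. [claim: Joshi2024ATS4, status:
disputed] -/
def ITDConditions (P : NFPoint) (ℓ : ℕ) : Prop :=
  7 ≤ ℓ ∧ Cor22.CondP2 P ℓ ∧ Cor22.CondP5 P ℓ ∧ Cor22.CondP6 P ℓ

/-- **[J-IV] Thm. 5.7.1, GENERIC FORM** in the `ℓ`-window `W λ ℓ` and in the reading `ITD λ ℓ` of «satisfies Initial Theta Data … with the prime `ℓ`»
(p.53 l.31–45): «[hypotheses of §5.5 and Prop. 5.6.1: `Z = Z(Z,S)` an `S`-supported compactly bounded subset, `{2,∞} ⊆ S`, (5.6.2)] Let `d ∈ ℕ` … Then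
there exists a finite set `Exc = Exc(Z, d) ⊂ U(Q̄)_{≤d}`, depending only on `Z`, `d`, with the following properties: Suppose `x_λ ∈ Z ∩ U(Q̄)_{≤d}`
and `x_λ ∉ Exc` … Then there exists a prime `ℓ` satisfying [`W`] such that `C_λ` satisfies [`ITD`] with the prime `ℓ`». «Finite subset of
`U(Q̄)_{≤d}`» is counted through minimal polynomials (`GenEll.HasFinitelyManyPoints`, as in the tree's `Cor22.PartII`); `d ≥ 1` (flag (c)); `Z` on `U`
(flag (d)). Monotone in `W` and `ITD` (`thm571With_mono`). [claim: Joshi2024ATS4, status: disputed] -/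
def Thm571With (W ITD : NFPoint → ℕ → Prop) : Prop :=
  ∀ Z : CBData, Z.SupportContains {2} → Cond562 Z → ∀ d : ℕ, 1 ≤ d →
    ∃ Exc : Set NFPoint, HasFinitelyManyPoints Exc ∧ Exc ⊆ UPle d ∧
      ∀ P ∈ Z.toSet ∩ UPle d, P ∉ Exc → ∃ ℓ : ℕ, ℓ.Prime ∧ W P ℓ ∧ ITD P ℓ

/-- **[J-IV] Theorem 5.7.1 (The Existence Theorem), p.53 l.31–45, AS PRINTED** («my formulation of [Mochizuki, 2021d, Corollary 2.2]», p.53 l.23–24;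
«what appears below corresponds to [Mochizuki, 2021d, Corollary 2.2 (i,ii)] while … (iii) is subsumed in the proof of Theorem 7.1.1», p.53 l.27–29):
the printed `ℓ`-window (`printedWindow`: `δ = d*_mod`, «`log(2·δ·log(Q))`», `Q = Tate(C_λ/L)`) and the conclusion «satisfies Initial Theta Data [J-III
§3.1, §3.3] … with the prime `ℓ`» (`HasInitialThetaData`). OUR nearest typed object: `Cor22.PartII` ([IUTchIV] Cor. 2.2 (ii): wider (C1) window, plus
(C2), minus the Θ-data clause «TODO(L5)» there). Never asserted. [claim: Joshi2024ATS4, status: disputed] -/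
@[claim "Joshi2024ATS4" "disputed"]
def Thm571 : Prop := Thm571With printedWindow HasInitialThetaData

/-- **[J-IV] Thm. 5.7.1 with the `ℓ`-window of its proof** (Lem. 5.8.7 (1), p.56 l.35–36: «`log(2·δ·Q)`» = [IUTchIV] (C1) with Joshi's `δ = d*_mod`)
and the conclusion `HasInitialThetaData`. Never asserted. [claim: Joshi2024ATS4, status: disputed] -/
@[claim "Joshi2024ATS4" "disputed"]
def Thm571Lem587 : Prop := Thm571With lem587Window HasInitialThetaData

/-- `Thm571With` is monotone: a wider window and a weaker reading of the conclusion are implied. PROVED. [claim: Joshi2024ATS4, status: disputed] -/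
theorem thm571With_mono {W W' ITD ITD' : NFPoint → ℕ → Prop} (hW : ∀ P ℓ, ℓ.Prime → W P ℓ → W' P ℓ)
    (hI : ∀ P ℓ, ℓ.Prime → W P ℓ → ITD P ℓ → ITD' P ℓ) (h : Thm571With W ITD) : Thm571With W' ITD' := by
  intro Z h2 h562 d hd
  obtain ⟨Exc, hfin, hsub, hmain⟩ := h Z h2 h562 d hd
  refine ⟨Exc, hfin, hsub, fun P hP hPexc => ?_⟩
  obtain ⟨ℓ, hℓ, hW', hI'⟩ := hmain P hP hPexc
  exact ⟨ℓ, hℓ, hW P ℓ hℓ hW', hI P ℓ hℓ hW' hI'⟩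

end Existence

end Summit.ABC.IUTFork.Joshi.ATS4

end
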